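/-
Copyright (c) 2026 the pub-hodgecm-mathlib formalisation cell (harness21).  Prover seat hodgecm-mathlib-A-p06 (g28) — (R2-ram)∕ROAD W (N)-side, 2026-09-01.
ROAD W (W6-N), FILE B (the levels `(K♯_D, K, K♯_D ⊓ K)`): Kottwitz's NON-ELLIPTIC relation at the levels `(K♯_D, K, K♯_D ⊓ K)` of `U(Φ₂)(L⁺_v)` from ANY vertex-transitive, dart-transitive action of `U₂` on a
tree whose vertex ∕ edge stabilisers are `K♯_D` and `K` (in either order), `D` diagonal — statement-first over B-p08 (g28)'s (W1c)(W2); sibling of ★ B-p14 (g32)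
`RankOneEulerPoincareNonsplitRamifiedEllipticOfTreeAction` ((W6-E)).
-/
import Literature.NumberTheory.Rogawski1990.RankOneEulerPoincareNonsplitNonEllipticOfTreeActionLevels   -- FILE A (A-p06 g28): `epNonEllipticCombination_eq_zero_of_vertexAction_of_levels`, `mem_map_conj_glDiagonal_iff_of_diagonal`
import HarnessLib

/-!
# The non-elliptic Euler–Poincaré relation at the ramified levels `(K♯_D, K, K♯_D ⊓ K)` of `U(Φ₂)(L⁺_v)` from a tree action (ROAD W, wild places included) — FILE B

Topic `NumberTheory/Rogawski1990`, namespace `Literature.NumberTheory.Rogawski1990`.  THEOREMS ONLY: no definition, no named fact, no instance, no notation,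
no `sorry`; kernel lane.  Cell `pub/hodgecm-mathlib`, F0∕P3a, crux H413 = stmt-HodgeConjecture-24833, line «N6nsGerm», residue `stub_N6nsR2ram`; ROAD W
(MEMO `F0/P3a/F0P3a-p04/g13/MEMO-R2wild.F0P3a-p04g13.md`), brick (W6-N) (owner word B-p14 (g32) 2026-09-01T10:53:17Z; census
`F0/P3a/A-p06/g28/CENSUS-W6N-NonEllipticOfTreeAction.A-p06g28.md`).
HONEST LABEL: HC_CM is proved only modulo the cell's remaining named inputs (hLiu418, h413) until rung 0 closes; this file is unconditional orbit counting over ★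
engines and asserts nothing printed.

THE MATHEMATICS [Kottwitz1988, §2 Thm. 2 (non-elliptic case `O_γ(f_EP) = 0`); Serre1980Trees, I.6, II.1.1–1.3; Laumon1995, (5.3.2); Rogawski1990, §12.6 p. 174;
Tits1979, §2.7, §3.9].  At every ramified non-split place `w ∣ v`, `U₂ = U(Φ₂)(L⁺_v)` acts through `ρ : U(Φ₂)(E_w) → PGL₂(F_v)` on the tree `X` of `SL₂(F_v)` with
ONE orbit of vertices and ONE orbit of darts (inversions allowed), the two stabilisers being `K = U₂ ∩ GL₂(𝒪_w)` and `K♯_D = U₂ ∩ D GL₂(𝒪_w) D⁻¹` (`D` diagonal)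
in an order depending on the type of `E_w ∕ F_v`.  THIS FILE takes such an action as HYPOTHESES — exactly the binders of the elliptic sibling ★
`epEllipticRelation_vertexEdgeLevels_of_vertexAction_local` (p843743): `act : ↥U_w → W → W`, `act_one`, `act_mul`, `act_adj`, `h01`, `hV`, `hD`, and the two stabiliser
identifications `hKv`, `hKe` through the one-place model — plus ONE torus binder `hstep` («the diagonal translation `t_ϖ = diag(ϖ, (σ_w ϖ)⁻¹)` moves the base
vertex `x₀` to a neighbour», true at a ramified place since `ρ(t_ϖ) = [diag(N ϖ, 1)]` and `ord_F N ϖ = 1`), and concludes Kottwitz's NON-ELLIPTIC relation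
`((ν K♯_D).toReal : ℂ)⁻¹ Φ(⟦γ⟧, 𝟙_{K♯_D}) + ((ν K).toReal : ℂ)⁻¹ Φ(⟦γ⟧, 𝟙_K) − ((ν (K♯_D ⊓ K)).toReal : ℂ)⁻¹ Φ(⟦γ⟧, 𝟙_{K♯_D ⊓ K}) = 0` for `m` canonical and every
regular `γ ∈ U₂` with NON-COMPACT centraliser — the `hN` input of ★ `exists_epRelations_of_vertexEdgeLevels` (p843499) VERBATIM.  Route: `γ` is conjugate to a
regular DIAGONAL `δ` (★ (g-D) `exists_conj_val_eq_glDiagonal_of_not_compactSpace_centralizer`; both sides are class functions), `Z(δ)` is the split torus with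
generator `τ = e_w⁻¹ t_ϖ` modulo its compact core (★ `exists_splitTorus_generator_local_of_nonsplit`, ★ `compactCore_centralizer_local_facts_of_isRegularElt`), and ★
THEOREM C `epCombination_classOrbitalIntegral_eq_zero_of_vertexAction` (F0P2-p02 (g9)) applies once the three tree-side torus facts hold at `x₀`: `hstep` (binder),
and — DERIVED here from `hKv` for a DIAGONAL `D` — `t_ϖ^n x₀ = x₀ ⇒ n = 0` (diagonal elements of the vertex stabiliser have unit entries) and `δ x₀ = t_ϖ^k x₀`
(`δ = t_ϖ^k · u₀` with `u₀` diagonal of unit entries, rank one ★ `exists_valuation_apply_eq_zpow`) — all of this is FILE A's level-generic core ★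
`epNonEllipticCombination_eq_zero_of_vertexAction_of_levels`; THIS FILE (B) reads it at `(K♯_D, K, K♯_D ⊓ K)`, `D = glDiagonal 2 L_w dD`, in the two versions
`K♯_D`-VERTEX ∕ `K`-EDGE (`E_w = F_v(√π)`-type, all tame places) and `K`-VERTEX ∕ `K♯_D`-EDGE (`F_v(√u)`-type), keyed on `u : ↥U_w` like ★ p843743 §2∕§2′.

## References
* [Kottwitz1988] R. E. Kottwitz, *Tamagawa numbers*, Ann. of Math. 127 (1988), 629–646, §2 Theorem 2.
* [Serre1980Trees] J.-P. Serre, *Trees* (1980), I.6.1, II.1.1–1.3.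
* [Laumon1995] G. Laumon, *Cohomology of Drinfeld Modular Varieties* I (1996), Lemma (5.3.2) p. 136.
* [Rogawski1990] J. D. Rogawski, *Automorphic Representations of Unitary Groups in Three Variables* (1990), §12.6 p. 174; §3.6 pp. 31–32; §4.3 p. 43.
* [Tits1979] J. Tits, *Reductive groups over local fields*, PSPM 33.1 (1979), §2.7, §3.9.
-/

set_option autoImplicit false

noncomputable section

open scoped ValuativeRel Matrix MatrixGroups
open Matrix ValuativeRel NumberField IsDedekindDomain MulAction MeasureTheory Measure Topology

namespace Literature.NumberTheory.Rogawski1990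

open Literature.NumberTheory.Automorphic Literature.NumberTheory.Automorphic.UnitaryGroup Literature.Combinatorics.SimpleGraph
  Literature.NumberTheory.GaloisRepresentations

/-! ## The non-elliptic relation at `(K♯_D, K, K♯_D ⊓ K)`, `D = diag(dD)`, from a tree action of the one-place model `U_w` -/

section Levels

variable (L : Type) [Field L] [NumberField L] [IsCMField L] {v : HeightOneSpectrum (𝓞 ↥(maximalRealSubfield L))}
  (w : PlacesOver L v) (hw : IsCMField.complexConj L • w.1 = w.1)
  (ϖ : (w.1.adicCompletion L)ˣ) (hϖ : Valued.v (ϖ : w.1.adicCompletion L) = WithZero.exp (-1 : ℤ))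
  [MeasurableSpace ((cmDatum L 2 (Matrix.of fun i j : Fin 2 => if i.val + j.val + 1 = 2 then (1 : L) else 0)).Local v)] [BorelSpace ((cmDatum L 2 (Matrix.of fun i j : Fin 2 => if i.val + j.val + 1 = 2 then (1 : L) else 0)).Local v)]
  [∀ γ : (cmDatum L 2 (Matrix.of fun i j : Fin 2 => if i.val + j.val + 1 = 2 then (1 : L) else 0)).Local v,
    MeasurableSpace (((cmDatum L 2 (Matrix.of fun i j : Fin 2 => if i.val + j.val + 1 = 2 then (1 : L) else 0)).Local v) ⧸ Subgroup.centralizer ({γ} : Set ((cmDatum L 2 (Matrix.of fun i j : Fin 2 => if i.val + j.val + 1 = 2 then (1 : L) else 0)).Local v)))]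
  [∀ γ : (cmDatum L 2 (Matrix.of fun i j : Fin 2 => if i.val + j.val + 1 = 2 then (1 : L) else 0)).Local v,
    BorelSpace (((cmDatum L 2 (Matrix.of fun i j : Fin 2 => if i.val + j.val + 1 = 2 then (1 : L) else 0)).Local v) ⧸ Subgroup.centralizer ({γ} : Set ((cmDatum L 2 (Matrix.of fun i j : Fin 2 => if i.val + j.val + 1 = 2 then (1 : L) else 0)).Local v)))]
  (ν : Measure ((cmDatum L 2 (Matrix.of fun i j : Fin 2 => if i.val + j.val + 1 = 2 then (1 : L) else 0)).Local v)) [IsHaarMeasure ν] [ν.IsMulRightInvariant]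


set_option maxHeartbeats 400000 in
include hw hϖ in
/-- **(N) AT `(K♯_D, K, K♯_D ⊓ K)` FROM A TREE ACTION OF THE ONE-PLACE MODEL `U_w = U(σ_w, (Φ₂)_w) ≤ GL₂(L_w)`, `K♯_D`-VERTEX ∕ `K`-EDGE** (`E_w = F_v(√π)`-type: all
tamely ramified places, and the wild places with an anti-fixed uniformiser), `D = glDiagonal 2 L_w dD` DIAGONAL — the shape in which (W1c)(W2) are delivered
(B-p08 (g28): the action `act u : V(X) → V(X)` of `u : ↥U_w` on the tree of `SL₂(F_v)` through `ρ`, `Stab(x₀) = U_w ∩ D·GL₂(𝒪_w)·D⁻¹`, `Stab{x₀, x₁} = U_w ∩ GL₂(𝒪_w)`)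
plus ONE torus binder `hstep` (`t_ϖ = diag(ϖ, (σ_w ϖ)⁻¹)` moves `x₀` to a neighbour; `ϖ` ANY uniformiser of `L_w`).  CONCLUSION, for `m` canonical and every regular `γ ∈ U₂`
with non-compact centraliser: `((ν K♯_D).toReal : ℂ)⁻¹ Φ(⟦γ⟧, 𝟙_{K♯_D}) + ((ν K).toReal : ℂ)⁻¹ Φ(⟦γ⟧, 𝟙_K) − ((ν (K♯_D ⊓ K)).toReal : ℂ)⁻¹ Φ(⟦γ⟧, 𝟙_{K♯_D ⊓ K}) = 0` — the binder
`hN` of ★ `exists_epRelations_of_vertexEdgeLevels` ∕ ★ `exists_isLocSmooth_classOrbitalIntegral_eq_one_zero_of_vertexEdgeLevels` (p843499) at `D := glDiagonal 2 L_w dD`, tokens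
verbatim. [cite: Kottwitz1988, §2 Theorem 2] [cite: Serre1980Trees, I.6.1; II.1.1–1.3] [cite: Laumon1995, Lemma (5.3.2) p. 136] [cite: Rogawski1990, §12.6 p. 174] [cite: Tits1979, §2.7; §3.9] -/
theorem epNonEllipticRelation_vertexEdgeLevels_of_vertexAction_local
    (dD : Fin 2 → (w.1.adicCompletion L)ˣ)
    {m : OrbitalMeasureFamily ((cmDatum L 2 (Matrix.of fun i j : Fin 2 => if i.val + j.val + 1 = 2 then (1 : L) else 0)).Local v)}
    (hm : m.IsCanonical (fun γ => IsRegularElt (γ.val : GL (Fin 2) (UnitaryGroup.LocalRing L v))) ν)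
    {W : Type*} {X : SimpleGraph W} (hX : X.IsTree)
    (act : ↥(unitaryGroupOfForm (galAdicCompletionMap (L := L) (IsCMField.complexConj L) hw)
            (placeForm (Matrix.of fun i j : Fin 2 => if i.val + j.val + 1 = 2 then (1 : L) else 0) w.1)) → W → W)
    (act_one : ∀ x : W, act 1 x = x)
    (act_mul : ∀ (u u' : ↥(unitaryGroupOfForm (galAdicCompletionMap (L := L) (IsCMField.complexConj L) hw)
            (placeForm (Matrix.of fun i j : Fin 2 => if i.val + j.val + 1 = 2 then (1 : L) else 0) w.1))) (x : W), act (u * u') x = act u (act u' x))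
    (act_adj : ∀ (u : ↥(unitaryGroupOfForm (galAdicCompletionMap (L := L) (IsCMField.complexConj L) hw)
            (placeForm (Matrix.of fun i j : Fin 2 => if i.val + j.val + 1 = 2 then (1 : L) else 0) w.1))) (a b : W), X.Adj (act u a) (act u b) ↔ X.Adj a b)
    {x₀ x₁ : W} (h01 : X.Adj x₀ x₁)
    (hV : ∀ x : W, ∃ u : ↥(unitaryGroupOfForm (galAdicCompletionMap (L := L) (IsCMField.complexConj L) hw)
            (placeForm (Matrix.of fun i j : Fin 2 => if i.val + j.val + 1 = 2 then (1 : L) else 0) w.1)), act u x₀ = x)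
    (hD : ∀ a b : W, X.Adj a b → ∃ u : ↥(unitaryGroupOfForm (galAdicCompletionMap (L := L) (IsCMField.complexConj L) hw)
            (placeForm (Matrix.of fun i j : Fin 2 => if i.val + j.val + 1 = 2 then (1 : L) else 0) w.1)), act u x₀ = a ∧ act u x₁ = b)
    (hKv : ∀ u : ↥(unitaryGroupOfForm (galAdicCompletionMap (L := L) (IsCMField.complexConj L) hw)
            (placeForm (Matrix.of fun i j : Fin 2 => if i.val + j.val + 1 = 2 then (1 : L) else 0) w.1)),
      (u : GL (Fin 2) (w.1.adicCompletion L)) ∈ (glInt 2 (w.1.adicCompletion L)).map (MulAut.conj (glDiagonal 2 (w.1.adicCompletion L) dD)).toMonoidHom ↔ act u x₀ = x₀)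
    (hKe : ∀ u : ↥(unitaryGroupOfForm (galAdicCompletionMap (L := L) (IsCMField.complexConj L) hw)
            (placeForm (Matrix.of fun i j : Fin 2 => if i.val + j.val + 1 = 2 then (1 : L) else 0) w.1)),
      (u : GL (Fin 2) (w.1.adicCompletion L)) ∈ glInt 2 (w.1.adicCompletion L) ↔ s(act u x₀, act u x₁) = s(x₀, x₁))
    (hstep : ∀ u : ↥(unitaryGroupOfForm (galAdicCompletionMap (L := L) (IsCMField.complexConj L) hw)
            (placeForm (Matrix.of fun i j : Fin 2 => if i.val + j.val + 1 = 2 then (1 : L) else 0) w.1)),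
      ((u : GL (Fin 2) (w.1.adicCompletion L)) : Matrix (Fin 2) (Fin 2) (w.1.adicCompletion L)) =
        diagonal ![(ϖ : w.1.adicCompletion L), (galAdicCompletionMap (L := L) (IsCMField.complexConj L) hw (ϖ : w.1.adicCompletion L))⁻¹] →
      X.Adj x₀ (act u x₀))
    (γ : (cmDatum L 2 (Matrix.of fun i j : Fin 2 => if i.val + j.val + 1 = 2 then (1 : L) else 0)).Local v) (hreg : IsRegularElt (γ.val : GL (Fin 2) (UnitaryGroup.LocalRing L v)))
    (hnc : ¬ CompactSpace (Subgroup.centralizer ({γ} : Set ((cmDatum L 2 (Matrix.of fun i j : Fin 2 => if i.val + j.val + 1 = 2 then (1 : L) else 0)).Local v)))) :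
      (((ν ((((glInt 2 (w.1.adicCompletion L)).map (MulAut.conj (glDiagonal 2 (w.1.adicCompletion L) dD)).toMonoidHom).comap
          (((unitaryGroupOfForm (galAdicCompletionMap (L := L) (IsCMField.complexConj L) hw)
            (placeForm (Matrix.of fun i j : Fin 2 => if i.val + j.val + 1 = 2 then (1 : L) else 0) w.1)).subtype.comp
            (localNonsplitEquiv (IsCMField.complexConj L) (Matrix.of fun i j : Fin 2 => if i.val + j.val + 1 = 2 then (1 : L) else 0)
          (IsCMField.complexConj_ne_one L) w hw).toMonoidHom :
            (cmDatum L 2 (Matrix.of fun i j : Fin 2 => if i.val + j.val + 1 = 2 then (1 : L) else 0)).Local v →* GL (Fin 2) (w.1.adicCompletion L)))))).toReal : ℂ))⁻¹ *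
          classOrbitalIntegral m
            ((((((glInt 2 (w.1.adicCompletion L)).map (MulAut.conj (glDiagonal 2 (w.1.adicCompletion L) dD)).toMonoidHom).comap
          (((unitaryGroupOfForm (galAdicCompletionMap (L := L) (IsCMField.complexConj L) hw)
            (placeForm (Matrix.of fun i j : Fin 2 => if i.val + j.val + 1 = 2 then (1 : L) else 0) w.1)).subtype.comp
            (localNonsplitEquiv (IsCMField.complexConj L) (Matrix.of fun i j : Fin 2 => if i.val + j.val + 1 = 2 then (1 : L) else 0)
          (IsCMField.complexConj_ne_one L) w hw).toMonoidHom :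
            (cmDatum L 2 (Matrix.of fun i j : Fin 2 => if i.val + j.val + 1 = 2 then (1 : L) else 0)).Local v →* GL (Fin 2) (w.1.adicCompletion L)))) : Subgroup ((cmDatum L 2 (Matrix.of fun i j : Fin 2 => if i.val + j.val + 1 = 2 then (1 : L) else 0)).Local v)) : Set ((cmDatum L 2 (Matrix.of fun i j : Fin 2 => if i.val + j.val + 1 = 2 then (1 : L) else 0)).Local v)).indicator fun _ => (1 : ℂ))
            (ConjClasses.mk γ) +
        (((ν (cmLocalIntegralLevel L 2 (Matrix.of fun i j : Fin 2 => if i.val + j.val + 1 = 2 then (1 : L) else 0) v)).toReal : ℂ))⁻¹ *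
          classOrbitalIntegral m
            (((cmLocalIntegralLevel L 2 (Matrix.of fun i j : Fin 2 => if i.val + j.val + 1 = 2 then (1 : L) else 0) v) : Set ((cmDatum L 2 (Matrix.of fun i j : Fin 2 => if i.val + j.val + 1 = 2 then (1 : L) else 0)).Local v)).indicator fun _ => (1 : ℂ))
            (ConjClasses.mk γ) -
        (((ν ((((glInt 2 (w.1.adicCompletion L)).map (MulAut.conj (glDiagonal 2 (w.1.adicCompletion L) dD)).toMonoidHom).comap
          (((unitaryGroupOfForm (galAdicCompletionMap (L := L) (IsCMField.complexConj L) hw)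
            (placeForm (Matrix.of fun i j : Fin 2 => if i.val + j.val + 1 = 2 then (1 : L) else 0) w.1)).subtype.comp
            (localNonsplitEquiv (IsCMField.complexConj L) (Matrix.of fun i j : Fin 2 => if i.val + j.val + 1 = 2 then (1 : L) else 0)
          (IsCMField.complexConj_ne_one L) w hw).toMonoidHom :
            (cmDatum L 2 (Matrix.of fun i j : Fin 2 => if i.val + j.val + 1 = 2 then (1 : L) else 0)).Local v →* GL (Fin 2) (w.1.adicCompletion L)))) ⊓
            cmLocalIntegralLevel L 2 (Matrix.of fun i j : Fin 2 => if i.val + j.val + 1 = 2 then (1 : L) else 0) v)).toReal : ℂ))⁻¹ *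
          classOrbitalIntegral m
            ((((((glInt 2 (w.1.adicCompletion L)).map (MulAut.conj (glDiagonal 2 (w.1.adicCompletion L) dD)).toMonoidHom).comap
          (((unitaryGroupOfForm (galAdicCompletionMap (L := L) (IsCMField.complexConj L) hw)
            (placeForm (Matrix.of fun i j : Fin 2 => if i.val + j.val + 1 = 2 then (1 : L) else 0) w.1)).subtype.comp
            (localNonsplitEquiv (IsCMField.complexConj L) (Matrix.of fun i j : Fin 2 => if i.val + j.val + 1 = 2 then (1 : L) else 0)
          (IsCMField.complexConj_ne_one L) w hw).toMonoidHom :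
            (cmDatum L 2 (Matrix.of fun i j : Fin 2 => if i.val + j.val + 1 = 2 then (1 : L) else 0)).Local v →* GL (Fin 2) (w.1.adicCompletion L)))) ⊓
              cmLocalIntegralLevel L 2 (Matrix.of fun i j : Fin 2 => if i.val + j.val + 1 = 2 then (1 : L) else 0) v : Subgroup ((cmDatum L 2 (Matrix.of fun i j : Fin 2 => if i.val + j.val + 1 = 2 then (1 : L) else 0)).Local v)) : Set ((cmDatum L 2 (Matrix.of fun i j : Fin 2 => if i.val + j.val + 1 = 2 then (1 : L) else 0)).Local v)).indicator fun _ => (1 : ℂ))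
            (ConjClasses.mk γ) = 0 := by
  obtain ⟨hSc, hSo⟩ := isCompact_isOpen_comap_map_conj_glInt L w hw (glDiagonal 2 (w.1.adicCompletion L) dD)
  obtain ⟨hKc, hKo⟩ := isCompact_isOpen_cmLocalIntegralLevel L 2 (Matrix.of fun i j : Fin 2 => if i.val + j.val + 1 = 2 then (1 : L) else 0) v
  obtain ⟨hIc, hIo⟩ := isCompact_isOpen_comap_map_conj_glInt_inf_cmLocalIntegralLevel L w hw (glDiagonal 2 (w.1.adicCompletion L) dD)
  refine epNonEllipticCombination_eq_zero_of_vertexAction_of_levels L w hw ϖ hϖ ν hm hX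
    (fun g => act ((localNonsplitEquiv (IsCMField.complexConj L) (Matrix.of fun i j : Fin 2 => if i.val + j.val + 1 = 2 then (1 : L) else 0)
          (IsCMField.complexConj_ne_one L) w hw) g))
    (fun x => by
      -- `e_w 1 = 1`, read through the (definitionally equal) group structures of `U₂` and of the one-place model's source
      have h1 := congrArg (fun u => act u x) (map_one (localNonsplitEquiv (IsCMField.complexConj L) (Matrix.of fun i j : Fin 2 => if i.val + j.val + 1 = 2 then (1 : L) else 0)
          (IsCMField.complexConj_ne_one L) w hw))
      exact h1.trans (act_one x))
    (fun g h x => by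
      have h2 := congrArg (fun u => act u x) (map_mul (localNonsplitEquiv (IsCMField.complexConj L) (Matrix.of fun i j : Fin 2 => if i.val + j.val + 1 = 2 then (1 : L) else 0)
          (IsCMField.complexConj_ne_one L) w hw) g h)
      exact h2.trans (act_mul _ _ x))
    (fun g a b => act_adj _ a b) h01
    (fun x => by
      obtain ⟨u, hu⟩ := hV x
      exact ⟨(localNonsplitEquiv (IsCMField.complexConj L) (Matrix.of fun i j : Fin 2 => if i.val + j.val + 1 = 2 then (1 : L) else 0)
          (IsCMField.complexConj_ne_one L) w hw).symm u,
        by simpa only [ContinuousMulEquiv.apply_symm_apply] using hu⟩)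
    (fun a b hab => by
      obtain ⟨u, hu⟩ := hD a b hab
      exact ⟨(localNonsplitEquiv (IsCMField.complexConj L) (Matrix.of fun i j : Fin 2 => if i.val + j.val + 1 = 2 then (1 : L) else 0)
          (IsCMField.complexConj_ne_one L) w hw).symm u,
        by simpa only [ContinuousMulEquiv.apply_symm_apply] using hu⟩)
    _ _ _ (fun g => ?_) (fun g => ?_) (fun g => ?_) hSo hSc hKo hKc hIo hIc (fun g hg => ?_) (fun g hg => hstep _ hg) γ hreg hnc
  · rw [← hKv]; exact mem_comap_map_conj_glInt_iff L w hw (glDiagonal 2 (w.1.adicCompletion L) dD) g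
  · rw [← hKe]; exact mem_localIntegralLevel_iff_of_smul_eq (IsCMField.complexConj L) 2 _ (IsCMField.complexConj_ne_one L) w hw g
  · have hK : g ∈ cmLocalIntegralLevel L 2 (Matrix.of fun i j : Fin 2 => if i.val + j.val + 1 = 2 then (1 : L) else 0) v ↔
        s(act ((localNonsplitEquiv (IsCMField.complexConj L) (Matrix.of fun i j : Fin 2 => if i.val + j.val + 1 = 2 then (1 : L) else 0)
          (IsCMField.complexConj_ne_one L) w hw) g) x₀, act ((localNonsplitEquiv (IsCMField.complexConj L) (Matrix.of fun i j : Fin 2 => if i.val + j.val + 1 = 2 then (1 : L) else 0)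
          (IsCMField.complexConj_ne_one L) w hw) g) x₁) = s(x₀, x₁) := by
      rw [← hKe]; exact mem_localIntegralLevel_iff_of_smul_eq (IsCMField.complexConj L) 2 _ (IsCMField.complexConj_ne_one L) w hw g
    rw [Subgroup.mem_inf, mem_comap_map_conj_glInt_iff L w hw (glDiagonal 2 (w.1.adicCompletion L) dD) g, hKv, hK]
    -- `g` fixes `x₀` and the edge `{x₀, x₁}` iff it fixes the dart `(x₀, x₁)`
    constructor
    · rintro ⟨h0, he⟩
      refine ⟨h0, ?_⟩
      rw [h0] at he
      rcases Sym2.eq_iff.1 he with ⟨-, h1⟩ | ⟨h1, h2⟩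
      · exact h1
      · rw [h2]; exact h1.symm ▸ rfl
    · rintro ⟨h0, h1⟩
      exact ⟨h0, by rw [h0, h1]⟩
  · exact (mem_comap_map_conj_glInt_iff L w hw (glDiagonal 2 (w.1.adicCompletion L) dD) g).trans (mem_map_conj_glDiagonal_iff_of_diagonal dD hg)

set_option maxHeartbeats 400000 in
include hw hϖ in
/-- **(N) AT `(K♯_D, K, K♯_D ⊓ K)` FROM A TREE ACTION OF THE ONE-PLACE MODEL `U_w`, `K`-VERTEX ∕ `K♯_D`-EDGE** (`F_v(√u)`-type wild places: the roles of the two lattice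
stabilisers are swapped, MEMO (S4)); same conclusion, same tokens (the combination is symmetric in the two levels). [cite: Kottwitz1988, §2 Theorem 2]
[cite: Serre1980Trees, I.6.1; II.1.1–1.3] [cite: Laumon1995, Lemma (5.3.2) p. 136] [cite: Rogawski1990, §12.6 p. 174] [cite: Tits1979, §2.7; §3.9] -/
theorem epNonEllipticRelation_vertexEdgeLevels_of_vertexAction_local'
    (dD : Fin 2 → (w.1.adicCompletion L)ˣ)
    {m : OrbitalMeasureFamily ((cmDatum L 2 (Matrix.of fun i j : Fin 2 => if i.val + j.val + 1 = 2 then (1 : L) else 0)).Local v)}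
    (hm : m.IsCanonical (fun γ => IsRegularElt (γ.val : GL (Fin 2) (UnitaryGroup.LocalRing L v))) ν)
    {W : Type*} {X : SimpleGraph W} (hX : X.IsTree)
    (act : ↥(unitaryGroupOfForm (galAdicCompletionMap (L := L) (IsCMField.complexConj L) hw)
            (placeForm (Matrix.of fun i j : Fin 2 => if i.val + j.val + 1 = 2 then (1 : L) else 0) w.1)) → W → W)
    (act_one : ∀ x : W, act 1 x = x)
    (act_mul : ∀ (u u' : ↥(unitaryGroupOfForm (galAdicCompletionMap (L := L) (IsCMField.complexConj L) hw)
            (placeForm (Matrix.of fun i j : Fin 2 => if i.val + j.val + 1 = 2 then (1 : L) else 0) w.1))) (x : W), act (u * u') x = act u (act u' x))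
    (act_adj : ∀ (u : ↥(unitaryGroupOfForm (galAdicCompletionMap (L := L) (IsCMField.complexConj L) hw)
            (placeForm (Matrix.of fun i j : Fin 2 => if i.val + j.val + 1 = 2 then (1 : L) else 0) w.1))) (a b : W), X.Adj (act u a) (act u b) ↔ X.Adj a b)
    {x₀ x₁ : W} (h01 : X.Adj x₀ x₁)
    (hV : ∀ x : W, ∃ u : ↥(unitaryGroupOfForm (galAdicCompletionMap (L := L) (IsCMField.complexConj L) hw)
            (placeForm (Matrix.of fun i j : Fin 2 => if i.val + j.val + 1 = 2 then (1 : L) else 0) w.1)), act u x₀ = x)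
    (hD : ∀ a b : W, X.Adj a b → ∃ u : ↥(unitaryGroupOfForm (galAdicCompletionMap (L := L) (IsCMField.complexConj L) hw)
            (placeForm (Matrix.of fun i j : Fin 2 => if i.val + j.val + 1 = 2 then (1 : L) else 0) w.1)), act u x₀ = a ∧ act u x₁ = b)
    (hKv : ∀ u : ↥(unitaryGroupOfForm (galAdicCompletionMap (L := L) (IsCMField.complexConj L) hw)
            (placeForm (Matrix.of fun i j : Fin 2 => if i.val + j.val + 1 = 2 then (1 : L) else 0) w.1)),
      (u : GL (Fin 2) (w.1.adicCompletion L)) ∈ glInt 2 (w.1.adicCompletion L) ↔ act u x₀ = x₀)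
    (hKe : ∀ u : ↥(unitaryGroupOfForm (galAdicCompletionMap (L := L) (IsCMField.complexConj L) hw)
            (placeForm (Matrix.of fun i j : Fin 2 => if i.val + j.val + 1 = 2 then (1 : L) else 0) w.1)),
      (u : GL (Fin 2) (w.1.adicCompletion L)) ∈ (glInt 2 (w.1.adicCompletion L)).map (MulAut.conj (glDiagonal 2 (w.1.adicCompletion L) dD)).toMonoidHom ↔ s(act u x₀, act u x₁) = s(x₀, x₁))
    (hstep : ∀ u : ↥(unitaryGroupOfForm (galAdicCompletionMap (L := L) (IsCMField.complexConj L) hw)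
            (placeForm (Matrix.of fun i j : Fin 2 => if i.val + j.val + 1 = 2 then (1 : L) else 0) w.1)),
      ((u : GL (Fin 2) (w.1.adicCompletion L)) : Matrix (Fin 2) (Fin 2) (w.1.adicCompletion L)) =
        diagonal ![(ϖ : w.1.adicCompletion L), (galAdicCompletionMap (L := L) (IsCMField.complexConj L) hw (ϖ : w.1.adicCompletion L))⁻¹] →
      X.Adj x₀ (act u x₀))
    (γ : (cmDatum L 2 (Matrix.of fun i j : Fin 2 => if i.val + j.val + 1 = 2 then (1 : L) else 0)).Local v) (hreg : IsRegularElt (γ.val : GL (Fin 2) (UnitaryGroup.LocalRing L v)))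
    (hnc : ¬ CompactSpace (Subgroup.centralizer ({γ} : Set ((cmDatum L 2 (Matrix.of fun i j : Fin 2 => if i.val + j.val + 1 = 2 then (1 : L) else 0)).Local v)))) :
      (((ν ((((glInt 2 (w.1.adicCompletion L)).map (MulAut.conj (glDiagonal 2 (w.1.adicCompletion L) dD)).toMonoidHom).comap
          (((unitaryGroupOfForm (galAdicCompletionMap (L := L) (IsCMField.complexConj L) hw)
            (placeForm (Matrix.of fun i j : Fin 2 => if i.val + j.val + 1 = 2 then (1 : L) else 0) w.1)).subtype.comp
            (localNonsplitEquiv (IsCMField.complexConj L) (Matrix.of fun i j : Fin 2 => if i.val + j.val + 1 = 2 then (1 : L) else 0)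
          (IsCMField.complexConj_ne_one L) w hw).toMonoidHom :
            (cmDatum L 2 (Matrix.of fun i j : Fin 2 => if i.val + j.val + 1 = 2 then (1 : L) else 0)).Local v →* GL (Fin 2) (w.1.adicCompletion L)))))).toReal : ℂ))⁻¹ *
          classOrbitalIntegral m
            ((((((glInt 2 (w.1.adicCompletion L)).map (MulAut.conj (glDiagonal 2 (w.1.adicCompletion L) dD)).toMonoidHom).comap
          (((unitaryGroupOfForm (galAdicCompletionMap (L := L) (IsCMField.complexConj L) hw)
            (placeForm (Matrix.of fun i j : Fin 2 => if i.val + j.val + 1 = 2 then (1 : L) else 0) w.1)).subtype.comp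
            (localNonsplitEquiv (IsCMField.complexConj L) (Matrix.of fun i j : Fin 2 => if i.val + j.val + 1 = 2 then (1 : L) else 0)
          (IsCMField.complexConj_ne_one L) w hw).toMonoidHom :
            (cmDatum L 2 (Matrix.of fun i j : Fin 2 => if i.val + j.val + 1 = 2 then (1 : L) else 0)).Local v →* GL (Fin 2) (w.1.adicCompletion L)))) : Subgroup ((cmDatum L 2 (Matrix.of fun i j : Fin 2 => if i.val + j.val + 1 = 2 then (1 : L) else 0)).Local v)) : Set ((cmDatum L 2 (Matrix.of fun i j : Fin 2 => if i.val + j.val + 1 = 2 then (1 : L) else 0)).Local v)).indicator fun _ => (1 : ℂ))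
            (ConjClasses.mk γ) +
        (((ν (cmLocalIntegralLevel L 2 (Matrix.of fun i j : Fin 2 => if i.val + j.val + 1 = 2 then (1 : L) else 0) v)).toReal : ℂ))⁻¹ *
          classOrbitalIntegral m
            (((cmLocalIntegralLevel L 2 (Matrix.of fun i j : Fin 2 => if i.val + j.val + 1 = 2 then (1 : L) else 0) v) : Set ((cmDatum L 2 (Matrix.of fun i j : Fin 2 => if i.val + j.val + 1 = 2 then (1 : L) else 0)).Local v)).indicator fun _ => (1 : ℂ))
            (ConjClasses.mk γ) -
        (((ν ((((glInt 2 (w.1.adicCompletion L)).map (MulAut.conj (glDiagonal 2 (w.1.adicCompletion L) dD)).toMonoidHom).comap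
          (((unitaryGroupOfForm (galAdicCompletionMap (L := L) (IsCMField.complexConj L) hw)
            (placeForm (Matrix.of fun i j : Fin 2 => if i.val + j.val + 1 = 2 then (1 : L) else 0) w.1)).subtype.comp
            (localNonsplitEquiv (IsCMField.complexConj L) (Matrix.of fun i j : Fin 2 => if i.val + j.val + 1 = 2 then (1 : L) else 0)
          (IsCMField.complexConj_ne_one L) w hw).toMonoidHom :
            (cmDatum L 2 (Matrix.of fun i j : Fin 2 => if i.val + j.val + 1 = 2 then (1 : L) else 0)).Local v →* GL (Fin 2) (w.1.adicCompletion L)))) ⊓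
            cmLocalIntegralLevel L 2 (Matrix.of fun i j : Fin 2 => if i.val + j.val + 1 = 2 then (1 : L) else 0) v)).toReal : ℂ))⁻¹ *
          classOrbitalIntegral m
            ((((((glInt 2 (w.1.adicCompletion L)).map (MulAut.conj (glDiagonal 2 (w.1.adicCompletion L) dD)).toMonoidHom).comap
          (((unitaryGroupOfForm (galAdicCompletionMap (L := L) (IsCMField.complexConj L) hw)
            (placeForm (Matrix.of fun i j : Fin 2 => if i.val + j.val + 1 = 2 then (1 : L) else 0) w.1)).subtype.comp
            (localNonsplitEquiv (IsCMField.complexConj L) (Matrix.of fun i j : Fin 2 => if i.val + j.val + 1 = 2 then (1 : L) else 0)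
          (IsCMField.complexConj_ne_one L) w hw).toMonoidHom :
            (cmDatum L 2 (Matrix.of fun i j : Fin 2 => if i.val + j.val + 1 = 2 then (1 : L) else 0)).Local v →* GL (Fin 2) (w.1.adicCompletion L)))) ⊓
              cmLocalIntegralLevel L 2 (Matrix.of fun i j : Fin 2 => if i.val + j.val + 1 = 2 then (1 : L) else 0) v : Subgroup ((cmDatum L 2 (Matrix.of fun i j : Fin 2 => if i.val + j.val + 1 = 2 then (1 : L) else 0)).Local v)) : Set ((cmDatum L 2 (Matrix.of fun i j : Fin 2 => if i.val + j.val + 1 = 2 then (1 : L) else 0)).Local v)).indicator fun _ => (1 : ℂ))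
            (ConjClasses.mk γ) = 0 := by
  obtain ⟨hSc, hSo⟩ := isCompact_isOpen_comap_map_conj_glInt L w hw (glDiagonal 2 (w.1.adicCompletion L) dD)
  obtain ⟨hKc, hKo⟩ := isCompact_isOpen_cmLocalIntegralLevel L 2 (Matrix.of fun i j : Fin 2 => if i.val + j.val + 1 = 2 then (1 : L) else 0) v
  obtain ⟨hIc, hIo⟩ := isCompact_isOpen_comap_map_conj_glInt_inf_cmLocalIntegralLevel L w hw (glDiagonal 2 (w.1.adicCompletion L) dD)
  have h := epNonEllipticCombination_eq_zero_of_vertexAction_of_levels L w hw ϖ hϖ ν hm hX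
    (fun g => act ((localNonsplitEquiv (IsCMField.complexConj L) (Matrix.of fun i j : Fin 2 => if i.val + j.val + 1 = 2 then (1 : L) else 0)
          (IsCMField.complexConj_ne_one L) w hw) g))
    (fun x => by
      -- `e_w 1 = 1`, read through the (definitionally equal) group structures of `U₂` and of the one-place model's source
      have h1 := congrArg (fun u => act u x) (map_one (localNonsplitEquiv (IsCMField.complexConj L) (Matrix.of fun i j : Fin 2 => if i.val + j.val + 1 = 2 then (1 : L) else 0)
          (IsCMField.complexConj_ne_one L) w hw))
      exact h1.trans (act_one x))
    (fun g h x => by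
      have h2 := congrArg (fun u => act u x) (map_mul (localNonsplitEquiv (IsCMField.complexConj L) (Matrix.of fun i j : Fin 2 => if i.val + j.val + 1 = 2 then (1 : L) else 0)
          (IsCMField.complexConj_ne_one L) w hw) g h)
      exact h2.trans (act_mul _ _ x))
    (fun g a b => act_adj _ a b) h01
    (fun x => by
      obtain ⟨u, hu⟩ := hV x
      exact ⟨(localNonsplitEquiv (IsCMField.complexConj L) (Matrix.of fun i j : Fin 2 => if i.val + j.val + 1 = 2 then (1 : L) else 0)
          (IsCMField.complexConj_ne_one L) w hw).symm u,
        by simpa only [ContinuousMulEquiv.apply_symm_apply] using hu⟩)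
    (fun a b hab => by
      obtain ⟨u, hu⟩ := hD a b hab
      exact ⟨(localNonsplitEquiv (IsCMField.complexConj L) (Matrix.of fun i j : Fin 2 => if i.val + j.val + 1 = 2 then (1 : L) else 0)
          (IsCMField.complexConj_ne_one L) w hw).symm u,
        by simpa only [ContinuousMulEquiv.apply_symm_apply] using hu⟩)
    (cmLocalIntegralLevel L 2 (Matrix.of fun i j : Fin 2 => if i.val + j.val + 1 = 2 then (1 : L) else 0) v)
    ((((glInt 2 (w.1.adicCompletion L)).map (MulAut.conj (glDiagonal 2 (w.1.adicCompletion L) dD)).toMonoidHom).comap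
          (((unitaryGroupOfForm (galAdicCompletionMap (L := L) (IsCMField.complexConj L) hw)
            (placeForm (Matrix.of fun i j : Fin 2 => if i.val + j.val + 1 = 2 then (1 : L) else 0) w.1)).subtype.comp
            (localNonsplitEquiv (IsCMField.complexConj L) (Matrix.of fun i j : Fin 2 => if i.val + j.val + 1 = 2 then (1 : L) else 0)
          (IsCMField.complexConj_ne_one L) w hw).toMonoidHom :
            (cmDatum L 2 (Matrix.of fun i j : Fin 2 => if i.val + j.val + 1 = 2 then (1 : L) else 0)).Local v →* GL (Fin 2) (w.1.adicCompletion L)))))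
    (((((glInt 2 (w.1.adicCompletion L)).map (MulAut.conj (glDiagonal 2 (w.1.adicCompletion L) dD)).toMonoidHom).comap
          (((unitaryGroupOfForm (galAdicCompletionMap (L := L) (IsCMField.complexConj L) hw)
            (placeForm (Matrix.of fun i j : Fin 2 => if i.val + j.val + 1 = 2 then (1 : L) else 0) w.1)).subtype.comp
            (localNonsplitEquiv (IsCMField.complexConj L) (Matrix.of fun i j : Fin 2 => if i.val + j.val + 1 = 2 then (1 : L) else 0)
          (IsCMField.complexConj_ne_one L) w hw).toMonoidHom :
            (cmDatum L 2 (Matrix.of fun i j : Fin 2 => if i.val + j.val + 1 = 2 then (1 : L) else 0)).Local v →* GL (Fin 2) (w.1.adicCompletion L))))) ⊓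
      cmLocalIntegralLevel L 2 (Matrix.of fun i j : Fin 2 => if i.val + j.val + 1 = 2 then (1 : L) else 0) v)
    (fun g => ?_) (fun g => ?_) (fun g => ?_) hKo hKc hSo hSc hIo hIc (fun g _ => ?_) (fun g hg => hstep _ hg) γ hreg hnc
  · rw [add_comm] at h
    exact h
  · rw [← hKv]; exact mem_localIntegralLevel_iff_of_smul_eq (IsCMField.complexConj L) 2 _ (IsCMField.complexConj_ne_one L) w hw g
  · rw [← hKe]; exact mem_comap_map_conj_glInt_iff L w hw (glDiagonal 2 (w.1.adicCompletion L) dD) g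
  · have hK : g ∈ cmLocalIntegralLevel L 2 (Matrix.of fun i j : Fin 2 => if i.val + j.val + 1 = 2 then (1 : L) else 0) v ↔
        act ((localNonsplitEquiv (IsCMField.complexConj L) (Matrix.of fun i j : Fin 2 => if i.val + j.val + 1 = 2 then (1 : L) else 0)
          (IsCMField.complexConj_ne_one L) w hw) g) x₀ = x₀ := by
      rw [← hKv]; exact mem_localIntegralLevel_iff_of_smul_eq (IsCMField.complexConj L) 2 _ (IsCMField.complexConj_ne_one L) w hw g
    rw [Subgroup.mem_inf, mem_comap_map_conj_glInt_iff L w hw (glDiagonal 2 (w.1.adicCompletion L) dD) g, hKe, hK]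
    constructor
    · rintro ⟨he, h0⟩
      refine ⟨h0, ?_⟩
      rw [h0] at he
      rcases Sym2.eq_iff.1 he with ⟨-, h1⟩ | ⟨h1, h2⟩
      · exact h1
      · rw [h2]; exact h1.symm ▸ rfl
    · rintro ⟨h0, h1⟩
      exact ⟨by rw [h0, h1], h0⟩
  · exact mem_localIntegralLevel_iff_of_smul_eq (IsCMField.complexConj L) 2 _ (IsCMField.complexConj_ne_one L) w hw g

end Levels

end Literature.NumberTheory.Rogawski1990

end
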